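import Literature.Analysis.FluidPDE.TorusNSGevreySums
import HarnessLib

/-!
# Sobolev interpolation on `T^d` by Cauchy–Schwarz in Fourier variables

Analysis/FunctionSpaces support file (everything proved; no definitions, no named facts). For a smooth
real vector field `v : T^d → ℝ^d` on the flat unit torus write `v̂(k) = 𝓕(complexify ∘ v)(k)` and
`a(k) = 4π²|k|²` (the symbol of `-Δ`). Parseval and the symbols of `∂ᵢ`, `Δ` (Grafakos 2014,
Prop. 3.2.6 (8), Prop. 3.2.7 (3)) read the classical homogeneous Sobolev quantities as spectral moments:

  `‖∇v‖₂² = ∑ₖ a ‖v̂‖²`, `‖Δv‖₂² = ∑ₖ a² ‖v̂‖²`, `‖∇Δv‖₂² = ∑ₖ a³ ‖v̂‖²`,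
  `‖Δ²v‖₂² = ∑ₖ a⁴ ‖v̂‖²`, `‖∇Δ²v‖₂² = ∑ₖ a⁵ ‖v̂‖²`

(`‖∇w‖₂² = Torus.gradNormSq w = ∫ ∑ᵢ ‖∂ᵢw‖²`; the first two identities are the tree's
`NSGevrey.hasSum_freqNormSq_mul_norm_sq_mFourierCoeff`, `NSGevrey.hasSum_freqNormSq_sq_mul_norm_sq_mFourierCoeff`,
the other three are recorded here). The Cauchy–Schwarz inequality for series,
`∑ z ≤ (∑ x)^{1/2} (∑ y)^{1/2}` whenever `z² ≤ x y` termwise (`x, y ≥ 0`), then gives the three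
**interpolation inequalities**

* `Torus.integral_norm_laplacian_sq_le_sqrt_mul_sqrt` — `‖Δv‖₂² ≤ ‖∇v‖₂ ‖∇Δv‖₂`;
* `Torus.gradNormSq_laplacian_le_sqrt_integral_mul_sqrt_integral` — `‖∇Δv‖₂² ≤ ‖Δv‖₂ ‖Δ²v‖₂`;
* `Torus.gradNormSq_laplacian_le_sqrt_gradNormSq_mul_sqrt_gradNormSq` — `‖∇Δv‖₂² ≤ ‖∇v‖₂ ‖∇Δ²v‖₂`,

and their squared forms (`‖Δv‖₂⁴ ≤ ‖∇v‖₂² ‖∇Δv‖₂²`, …): the log-convexity of `s ↦ ‖v‖_{Ḣˢ}` at the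
integer nodes `1 ≤ 2 ≤ 3`, `2 ≤ 3 ≤ 4`, `1 ≤ 3 ≤ 5` (the interpolation inequality between the domains of
the powers of the Stokes operator / of `-Δ`, Constantin–Foias 1988, Ch. 4). On sets with uniform high
Sobolev bounds they make the `H³` distance Hölder-controlled by the `H¹` distance. Everything is stated
for a general finite index type `d`; no dimension hypothesis is needed.

## Contents

* `§ CauchySchwarz` — `Torus.sum_le_sqrt_mul_sqrt_of_sq_le_mul` (finite sets),
  `Torus.hasSum_le_sqrt_mul_sqrt_of_sq_le_mul` (`HasSum` form), `Torus.hasSum_sq_le_mul_of_sq_le_mul`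
  (squared form), `Torus.summable_of_sq_le_mul`, `Torus.tsum_le_sqrt_tsum_mul_sqrt_tsum_of_sq_le_mul`;
* `§ Moments` — `Torus.norm_mFourierCoeff_complexify_laplacian` (`‖𝓕(Δv)(k)‖ = 4π²|k|² ‖v̂(k)‖`) and the
  `HasSum` identities for the third, fourth and fifth moments;
* `§ Interpolation` — the three inequalities and their squared forms.

## Mathlib / tree search

Mathlib: `Real.sum_sqrt_mul_sqrt_le` (Cauchy–Schwarz on a `Finset` with square roots),
`Real.inner_le_Lp_mul_Lq_tsum_of_nonneg` (Hölder for series with `rpow` exponents — not used: the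
`p = q = 2` case with `Real.sqrt` is shorter by hand), `hasSum_le_of_sum_le`, `sum_le_hasSum`.
Tree (`lean search 'interpolat' / 'sqrt \(gradNormSq' / 'gradNormSq \(laplacian'`):
`FluidPDE.Torus.latNormSq_interpolate` (`TorusLatticeNorms`, log-convexity of the INHOMOGENEOUS lattice
energies `∑ (1 + |k|²)^m ‖v̂‖²` via `rpow`-Hölder), `HomSobolevInterpolation` (`Ḣˢ(ℝⁿ)`),
`TorusSmallnessInterpolation` (Young's form of `‖∂ᵢu‖₂² ≤ ‖u‖₂‖∂ᵢ²u‖₂`); nothing for the homogeneous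
quantities `gradNormSq`, `∫ ‖Δ·‖²` used by the Navier–Stokes files. Reused:
`NSGevrey.hasSum_freqNormSq_mul_norm_sq_mFourierCoeff`, `NSGevrey.hasSum_freqNormSq_sq_mul_norm_sq_mFourierCoeff`
(`TorusNSGevreySums`), `Torus.mFourierCoeff_complexify_laplacian` (`TorusFourierModes`),
`Torus.IsSmooth.laplacian` (`TorusCalculus`).

## References

* L. Grafakos, *Classical Fourier Analysis*, 3rd ed., GTM 249 (2014), Prop. 3.2.6 (8), Prop. 3.2.7 (3).
  [Grafakos2014]
* P. Constantin, C. Foias, *Navier–Stokes Equations*, Chicago Lectures in Mathematics (1988), Ch. 4.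
  [ConstantinFoiasNSE1988]
-/

noncomputable section

open _root_.MeasureTheory Set Filter Function UnitAddTorus Finset
open scoped Topology BigOperators

namespace Literature.Analysis.FunctionSpaces

namespace Torus

/-! ### Cauchy–Schwarz for series of real numbers -/

section CauchySchwarz

variable {ι : Type*} {x y z : ι → ℝ} {X Y Z : ℝ}

/-- **Cauchy–Schwarz on a finite set, product-free form**: if `x, y ≥ 0` and `z² ≤ x y` termwise then
`∑_{i∈s} z i ≤ (∑_{i∈s} x i)^{1/2} (∑_{i∈s} y i)^{1/2}` (`z ≤ √x √y` termwise and Mathlib's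
`Real.sum_sqrt_mul_sqrt_le`). [folklore] -/
theorem sum_le_sqrt_mul_sqrt_of_sq_le_mul (s : Finset ι) (hx : ∀ i, 0 ≤ x i) (hy : ∀ i, 0 ≤ y i)
    (hxyz : ∀ i, z i ^ 2 ≤ x i * y i) :
    ∑ i ∈ s, z i ≤ Real.sqrt (∑ i ∈ s, x i) * Real.sqrt (∑ i ∈ s, y i) :=
  calc ∑ i ∈ s, z i ≤ ∑ i ∈ s, Real.sqrt (x i) * Real.sqrt (y i) :=
        Finset.sum_le_sum fun i _ => by
          rw [← Real.sqrt_mul (hx i)]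
          exact Real.le_sqrt_of_sq_le (hxyz i)
    _ ≤ Real.sqrt (∑ i ∈ s, x i) * Real.sqrt (∑ i ∈ s, y i) := Real.sum_sqrt_mul_sqrt_le s hx hy

/-- **Cauchy–Schwarz for series, `HasSum` form**: if `x, y ≥ 0`, `z² ≤ x y` termwise and
`∑ x = X`, `∑ y = Y`, `∑ z = Z`, then `Z ≤ √X √Y` (the finite-set inequality on every partial sum,
`∑_{s} x ≤ X`, `∑_{s} y ≤ Y`, and `Z` is the limit of the partial sums of `z`). [folklore] -/
theorem hasSum_le_sqrt_mul_sqrt_of_sq_le_mul (hx : ∀ i, 0 ≤ x i) (hy : ∀ i, 0 ≤ y i)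
    (hxyz : ∀ i, z i ^ 2 ≤ x i * y i) (hX : HasSum x X) (hY : HasSum y Y) (hZ : HasSum z Z) :
    Z ≤ Real.sqrt X * Real.sqrt Y :=
  hasSum_le_of_sum_le hZ fun s =>
    (sum_le_sqrt_mul_sqrt_of_sq_le_mul s hx hy hxyz).trans
      (mul_le_mul (Real.sqrt_le_sqrt (sum_le_hasSum s (fun i _ => hx i) hX))
        (Real.sqrt_le_sqrt (sum_le_hasSum s (fun i _ => hy i) hY)) (Real.sqrt_nonneg _)
        (Real.sqrt_nonneg _))

/-- **Cauchy–Schwarz for series, squared form**: under the hypotheses of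
`hasSum_le_sqrt_mul_sqrt_of_sq_le_mul`, `Z² ≤ X Y` (apply the previous inequality to `z` and to `-z`).
[folklore] -/
theorem hasSum_sq_le_mul_of_sq_le_mul (hx : ∀ i, 0 ≤ x i) (hy : ∀ i, 0 ≤ y i)
    (hxyz : ∀ i, z i ^ 2 ≤ x i * y i) (hX : HasSum x X) (hY : HasSum y Y) (hZ : HasSum z Z) :
    Z ^ 2 ≤ X * Y := by
  have hX0 : 0 ≤ X := hX.nonneg hx
  have hY0 : 0 ≤ Y := hY.nonneg hy
  have h1 : Z ≤ Real.sqrt (X * Y) := by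
    rw [Real.sqrt_mul hX0]
    exact hasSum_le_sqrt_mul_sqrt_of_sq_le_mul hx hy hxyz hX hY hZ
  have h2 : -Z ≤ Real.sqrt (X * Y) := by
    rw [Real.sqrt_mul hX0]
    exact hasSum_le_sqrt_mul_sqrt_of_sq_le_mul (z := fun i => -z i) hx hy
      (fun i => by rw [neg_sq]; exact hxyz i) hX hY hZ.neg
  exact (Real.sq_le (mul_nonneg hX0 hY0)).2 ⟨by linarith, h1⟩

/-- If `x, y ≥ 0` are summable and `z² ≤ x y` termwise then `z` is summable
(`|z| ≤ √(x y) ≤ x + y`, comparison test). [folklore] -/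
theorem summable_of_sq_le_mul (hx : ∀ i, 0 ≤ x i) (hy : ∀ i, 0 ≤ y i)
    (hxyz : ∀ i, z i ^ 2 ≤ x i * y i) (hxs : Summable x) (hys : Summable y) : Summable z := by
  refine Summable.of_norm_bounded (hxs.add hys) fun i => ?_
  rw [Real.norm_eq_abs]
  refine (Real.abs_le_sqrt (hxyz i)).trans (Real.sqrt_le_iff.2 ⟨add_nonneg (hx i) (hy i), ?_⟩)
  nlinarith [hx i, hy i]

/-- **Cauchy–Schwarz for series, `tsum` form**: if `x, y ≥ 0` are summable and `z² ≤ x y` termwise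
then `∑' z ≤ (∑' x)^{1/2} (∑' y)^{1/2}`. [folklore] -/
theorem tsum_le_sqrt_tsum_mul_sqrt_tsum_of_sq_le_mul (hx : ∀ i, 0 ≤ x i) (hy : ∀ i, 0 ≤ y i)
    (hxyz : ∀ i, z i ^ 2 ≤ x i * y i) (hxs : Summable x) (hys : Summable y) :
    ∑' i, z i ≤ Real.sqrt (∑' i, x i) * Real.sqrt (∑' i, y i) :=
  hasSum_le_sqrt_mul_sqrt_of_sq_le_mul hx hy hxyz hxs.hasSum hys.hasSum
    (summable_of_sq_le_mul hx hy hxyz hxs hys).hasSum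

end CauchySchwarz

/-! ### Spectral moments of a smooth field: the third, fourth and fifth moments -/

section Moments

open Literature.Analysis.FluidPDE

variable {d : Type*} [Fintype d] [DecidableEq d] {v : UnitAddTorus d → EuclideanSpace ℝ d}

omit [DecidableEq d] in
/-- The symbol `a(k) = 4π²|k|²` of `-Δ` is nonnegative. [folklore] -/
theorem four_mul_pi_sq_mul_freqNormSq_nonneg (k : d → ℤ) : 0 ≤ 4 * Real.pi ^ 2 * freqNormSq k := by
  have := freqNormSq_nonneg k
  positivity

/-- **Norm of the Fourier coefficients of the Laplacian**: `‖𝓕(complexify ∘ Δv)(k)‖ = 4π²|k|² ‖v̂(k)‖`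
for smooth `v : T^d → ℝ^d` (the symbol `-4π²|k|²`, Grafakos 2014, Prop. 3.2.6 (8);
`Torus.mFourierCoeff_complexify_laplacian`). [cite: Grafakos2014, Prop. 3.2.6] -/
theorem norm_mFourierCoeff_complexify_laplacian (hv : IsSmooth v) (k : d → ℤ) :
    ‖mFourierCoeff (EuclideanSpace.complexify ∘ laplacian v) k‖ =
      4 * Real.pi ^ 2 * freqNormSq k * ‖mFourierCoeff (EuclideanSpace.complexify ∘ v) k‖ := by
  rw [mFourierCoeff_complexify_laplacian hv k, norm_neg, norm_smul,
    Complex.norm_of_nonneg (four_mul_pi_sq_mul_freqNormSq_nonneg k)]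

/-- **Third spectral moment**: for smooth real `v`, `∑ₖ (4π²|k|²)³ ‖v̂(k)‖² = ‖∇Δv‖₂² = gradNormSq (Δv)`
as a `HasSum` (the enstrophy identity `NSGevrey.hasSum_freqNormSq_mul_norm_sq_mFourierCoeff` for the smooth
field `Δv`, whose coefficients are `-4π²|k|² v̂(k)`; Grafakos 2014, Prop. 3.2.7 (3)).
[cite: Grafakos2014, Prop. 3.2.7 (3)] -/
theorem hasSum_laplacianSymbol_pow_three_mul_norm_sq_mFourierCoeff (hv : IsSmooth v) :
    HasSum (fun k : d → ℤ => (4 * Real.pi ^ 2 * freqNormSq k) ^ 3 *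
      ‖mFourierCoeff (EuclideanSpace.complexify ∘ v) k‖ ^ 2) (gradNormSq (laplacian v)) := by
  refine (NSGevrey.hasSum_freqNormSq_mul_norm_sq_mFourierCoeff hv.laplacian).congr_fun fun k => ?_
  rw [norm_mFourierCoeff_complexify_laplacian hv k]
  ring

/-- **Fourth spectral moment**: for smooth real `v`, `∑ₖ (4π²|k|²)⁴ ‖v̂(k)‖² = ∫ ‖Δ²v‖²` as a `HasSum`
(Parseval for `Δ(Δv)`, `NSGevrey.hasSum_freqNormSq_sq_mul_norm_sq_mFourierCoeff` for the smooth field `Δv`;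
Grafakos 2014, Prop. 3.2.7 (3)). [cite: Grafakos2014, Prop. 3.2.7 (3)] -/
theorem hasSum_laplacianSymbol_pow_four_mul_norm_sq_mFourierCoeff (hv : IsSmooth v) :
    HasSum (fun k : d → ℤ => (4 * Real.pi ^ 2 * freqNormSq k) ^ 4 *
      ‖mFourierCoeff (EuclideanSpace.complexify ∘ v) k‖ ^ 2)
      (∫ x, ‖laplacian (laplacian v) x‖ ^ 2) := by
  refine (NSGevrey.hasSum_freqNormSq_sq_mul_norm_sq_mFourierCoeff hv.laplacian).congr_fun fun k => ?_
  rw [norm_mFourierCoeff_complexify_laplacian hv k]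
  ring

/-- **Fifth spectral moment**: for smooth real `v`, `∑ₖ (4π²|k|²)⁵ ‖v̂(k)‖² = ‖∇Δ²v‖₂² = gradNormSq (Δ²v)`
as a `HasSum` (the third-moment identity for the smooth field `Δv`; Grafakos 2014, Prop. 3.2.7 (3)).
[cite: Grafakos2014, Prop. 3.2.7 (3)] -/
theorem hasSum_laplacianSymbol_pow_five_mul_norm_sq_mFourierCoeff (hv : IsSmooth v) :
    HasSum (fun k : d → ℤ => (4 * Real.pi ^ 2 * freqNormSq k) ^ 5 *
      ‖mFourierCoeff (EuclideanSpace.complexify ∘ v) k‖ ^ 2)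
      (gradNormSq (laplacian (laplacian v))) := by
  refine (hasSum_laplacianSymbol_pow_three_mul_norm_sq_mFourierCoeff hv.laplacian).congr_fun fun k => ?_
  rw [norm_mFourierCoeff_complexify_laplacian hv k]
  ring

end Moments

/-! ### The interpolation inequalities -/

section Interpolation

open Literature.Analysis.FluidPDE

variable {d : Type*} [Fintype d] [DecidableEq d] {v : UnitAddTorus d → EuclideanSpace ℝ d}

/-- **`‖Δv‖₂² ≤ ‖∇v‖₂ ‖∇Δv‖₂`** for smooth real `v` on `T^d`:
`∫ ‖Δv‖² ≤ (gradNormSq v)^{1/2} (gradNormSq (Δv))^{1/2}` (Cauchy–Schwarz in Fourier variables: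
`∑ a²‖v̂‖² ≤ (∑ a‖v̂‖²)^{1/2} (∑ a³‖v̂‖²)^{1/2}`, `a = 4π²|k|²`; Constantin–Foias 1988, Ch. 4).
[folklore] -/
theorem integral_norm_laplacian_sq_le_sqrt_mul_sqrt (hv : IsSmooth v) :
    (∫ x, ‖laplacian v x‖ ^ 2) ≤ Real.sqrt (gradNormSq v) * Real.sqrt (gradNormSq (laplacian v)) :=
  hasSum_le_sqrt_mul_sqrt_of_sq_le_mul (fun k => mul_nonneg (four_mul_pi_sq_mul_freqNormSq_nonneg k) (sq_nonneg _))
    (fun k => mul_nonneg (pow_nonneg (four_mul_pi_sq_mul_freqNormSq_nonneg k) 3) (sq_nonneg _))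
    (fun k => le_of_eq (by ring)) (NSGevrey.hasSum_freqNormSq_mul_norm_sq_mFourierCoeff hv)
    (hasSum_laplacianSymbol_pow_three_mul_norm_sq_mFourierCoeff hv)
    (NSGevrey.hasSum_freqNormSq_sq_mul_norm_sq_mFourierCoeff hv)

/-- **`‖∇Δv‖₂² ≤ ‖Δv‖₂ ‖Δ²v‖₂`** for smooth real `v` on `T^d`:
`gradNormSq (Δv) ≤ (∫ ‖Δv‖²)^{1/2} (∫ ‖Δ²v‖²)^{1/2}` (Cauchy–Schwarz in Fourier variables:
`∑ a³‖v̂‖² ≤ (∑ a²‖v̂‖²)^{1/2} (∑ a⁴‖v̂‖²)^{1/2}`; equivalently `∫ ‖∇w‖² = -∫ ⟪w, Δw⟫ ≤ ‖w‖₂‖Δw‖₂` for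
`w = Δv`). [folklore] -/
theorem gradNormSq_laplacian_le_sqrt_integral_mul_sqrt_integral (hv : IsSmooth v) :
    gradNormSq (laplacian v) ≤
      Real.sqrt (∫ x, ‖laplacian v x‖ ^ 2) * Real.sqrt (∫ x, ‖laplacian (laplacian v) x‖ ^ 2) :=
  hasSum_le_sqrt_mul_sqrt_of_sq_le_mul
    (fun k => mul_nonneg (pow_nonneg (four_mul_pi_sq_mul_freqNormSq_nonneg k) 2) (sq_nonneg _))
    (fun k => mul_nonneg (pow_nonneg (four_mul_pi_sq_mul_freqNormSq_nonneg k) 4) (sq_nonneg _))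
    (fun k => le_of_eq (by ring)) (NSGevrey.hasSum_freqNormSq_sq_mul_norm_sq_mFourierCoeff hv)
    (hasSum_laplacianSymbol_pow_four_mul_norm_sq_mFourierCoeff hv)
    (hasSum_laplacianSymbol_pow_three_mul_norm_sq_mFourierCoeff hv)

/-- **`‖∇Δv‖₂² ≤ ‖∇v‖₂ ‖∇Δ²v‖₂`** for smooth real `v` on `T^d`:
`gradNormSq (Δv) ≤ (gradNormSq v)^{1/2} (gradNormSq (Δ²v))^{1/2}` (Cauchy–Schwarz in Fourier variables:
`∑ a³‖v̂‖² ≤ (∑ a‖v̂‖²)^{1/2} (∑ a⁵‖v̂‖²)^{1/2}`). [folklore] -/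
theorem gradNormSq_laplacian_le_sqrt_gradNormSq_mul_sqrt_gradNormSq (hv : IsSmooth v) :
    gradNormSq (laplacian v) ≤
      Real.sqrt (gradNormSq v) * Real.sqrt (gradNormSq (laplacian (laplacian v))) :=
  hasSum_le_sqrt_mul_sqrt_of_sq_le_mul (fun k => mul_nonneg (four_mul_pi_sq_mul_freqNormSq_nonneg k) (sq_nonneg _))
    (fun k => mul_nonneg (pow_nonneg (four_mul_pi_sq_mul_freqNormSq_nonneg k) 5) (sq_nonneg _))
    (fun k => le_of_eq (by ring)) (NSGevrey.hasSum_freqNormSq_mul_norm_sq_mFourierCoeff hv)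
    (hasSum_laplacianSymbol_pow_five_mul_norm_sq_mFourierCoeff hv)
    (hasSum_laplacianSymbol_pow_three_mul_norm_sq_mFourierCoeff hv)

/-- Squared form of `integral_norm_laplacian_sq_le_sqrt_mul_sqrt`:
**`‖Δv‖₂⁴ ≤ ‖∇v‖₂² ‖∇Δv‖₂²`**, i.e. `(∫ ‖Δv‖²)² ≤ gradNormSq v · gradNormSq (Δv)`. [folklore] -/
theorem integral_norm_laplacian_sq_sq_le_gradNormSq_mul_gradNormSq_laplacian (hv : IsSmooth v) :
    (∫ x, ‖laplacian v x‖ ^ 2) ^ 2 ≤ gradNormSq v * gradNormSq (laplacian v) :=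
  hasSum_sq_le_mul_of_sq_le_mul (fun k => mul_nonneg (four_mul_pi_sq_mul_freqNormSq_nonneg k) (sq_nonneg _))
    (fun k => mul_nonneg (pow_nonneg (four_mul_pi_sq_mul_freqNormSq_nonneg k) 3) (sq_nonneg _))
    (fun k => le_of_eq (by ring)) (NSGevrey.hasSum_freqNormSq_mul_norm_sq_mFourierCoeff hv)
    (hasSum_laplacianSymbol_pow_three_mul_norm_sq_mFourierCoeff hv)
    (NSGevrey.hasSum_freqNormSq_sq_mul_norm_sq_mFourierCoeff hv)

/-- Squared form of `gradNormSq_laplacian_le_sqrt_integral_mul_sqrt_integral`: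
**`‖∇Δv‖₂⁴ ≤ ‖Δv‖₂² ‖Δ²v‖₂²`**. [folklore] -/
theorem gradNormSq_laplacian_sq_le_integral_mul_integral (hv : IsSmooth v) :
    gradNormSq (laplacian v) ^ 2 ≤
      (∫ x, ‖laplacian v x‖ ^ 2) * ∫ x, ‖laplacian (laplacian v) x‖ ^ 2 :=
  hasSum_sq_le_mul_of_sq_le_mul
    (fun k => mul_nonneg (pow_nonneg (four_mul_pi_sq_mul_freqNormSq_nonneg k) 2) (sq_nonneg _))
    (fun k => mul_nonneg (pow_nonneg (four_mul_pi_sq_mul_freqNormSq_nonneg k) 4) (sq_nonneg _))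
    (fun k => le_of_eq (by ring)) (NSGevrey.hasSum_freqNormSq_sq_mul_norm_sq_mFourierCoeff hv)
    (hasSum_laplacianSymbol_pow_four_mul_norm_sq_mFourierCoeff hv)
    (hasSum_laplacianSymbol_pow_three_mul_norm_sq_mFourierCoeff hv)

/-- Squared form of `gradNormSq_laplacian_le_sqrt_gradNormSq_mul_sqrt_gradNormSq`:
**`‖∇Δv‖₂⁴ ≤ ‖∇v‖₂² ‖∇Δ²v‖₂²`**. [folklore] -/
theorem gradNormSq_laplacian_sq_le_gradNormSq_mul_gradNormSq (hv : IsSmooth v) :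
    gradNormSq (laplacian v) ^ 2 ≤ gradNormSq v * gradNormSq (laplacian (laplacian v)) :=
  hasSum_sq_le_mul_of_sq_le_mul (fun k => mul_nonneg (four_mul_pi_sq_mul_freqNormSq_nonneg k) (sq_nonneg _))
    (fun k => mul_nonneg (pow_nonneg (four_mul_pi_sq_mul_freqNormSq_nonneg k) 5) (sq_nonneg _))
    (fun k => le_of_eq (by ring)) (NSGevrey.hasSum_freqNormSq_mul_norm_sq_mFourierCoeff hv)
    (hasSum_laplacianSymbol_pow_five_mul_norm_sq_mFourierCoeff hv)
    (hasSum_laplacianSymbol_pow_three_mul_norm_sq_mFourierCoeff hv)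

end Interpolation

end Torus

end Literature.Analysis.FunctionSpaces
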